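import Summits.QuantumFields.YangMills.Theorems.ColdStartUniversalityLatticeLangevinBakryEmeryPoincare
import Summits.QuantumFields.YangMills.Theorems.ColdStartUniversalityColdStartSolutionsExistTruncatedBounds
import Summits.Ventures.YMGap.Thresholds.WilsonHessian
import HarnessLib

/-!
# Route `ColdStartUniversality` (fixed-cut-off package, Bakry–Émery side): the EXPLICIT, VOLUME-INDEPENDENT HESSIAN BOUND
# `K₀ = 24|β'|` for the plaquette function along the noise frame, and the UNCONDITIONAL volume-uniform Poincaré inequality
# `(1 − 12|β'|)·Var_(μ_β') F ≤ ℰ(F)` for the `SU(2)` Wilson measure on `(ℤ/L)³`, every `L`, `|β'| < 1/12`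

Helper file (seat `ym-line-csu-p1`, g25; `--supports stmt-QuantumFields-24809`).  Discharges the hypothesis `hHess` of
`wilson_generatorPoincare_of_hessBound` (`…BakryEmeryPoincare`) with the explicit constant `K₀ = 24|β'|`, using the venture's
SHARP lattice Hessian bound `|Hess(Σ_p Re tr U_p)(X,X)| ≤ 4d·Σ_e ‖X_e‖²` (`Summit.Ventures.YMGap.HessianSharp.abs_hessianForm_le_four_d`,
`d = 3`), transported to the noise frame of the tree's coordinate generator:
* `fderiv_frameDeriv_eq_mul_hessianForm` — the second frame derivative of a function that reads `β'·wilsonRe` through the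
  coordinates, along the exponential curve `t ↦ e^(tA)Q`, is `β'·hessianForm Q A` (chain rule twice + uniqueness of derivatives);
* ★★ `wilson_hessBound` — for every configuration `V` and functional `Λ`:
  `Σ_(n,m) Λ(s_n)Λ(s_m)·(W_n W_m ψ̂)(coords V) ≤ 24|β'|·Σ_n Λ(s_n)²` (`A_e = √2 Σ_ν Λ(s_(e,ν)) 𝐩E_ν`, `Σ_e‖A_e‖² ≤ 2Σ_nΛ(s_n)²`
  because `𝐩` is a contraction and `(E_ν)` is orthonormal);
* ★★★ `wilson_generatorPoincare_uniform` — for EVERY torus size `L`, every `|β'| < 1/12` and every `C³` cylinder function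
  `F = f∘coords`:  `(1 − 12|β'|)·∫ (F − μ_(β')F)² dμ_(β') ≤ −∫ (F − μ_(β')F)·𝓛_(β') f dμ_(β')`.
This is the Poincaré half of Shen–Zhu–Zhu, CMP 400 (2023), Theorem 4.2 / Cor. 4.4 for `SU(2)`, `d = 3`, in the tree's
normalisation (`Ric ≡ 1`, generator `= ½ Σ_n (W_n² + W_nψ̂·W_n)`), with the venture's sharper Hessian constant (`4d` in place of
SZZ's `8(d−1)`): spectral gap `≥ 1 − 12|β'|` uniformly in the volume.
THEOREMS ONLY, no definition, no sorry.  HONEST FRAMING: a fixed-cut-off, small-|β'| statement (RECORD-rung plumbing for the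
route's K_A1); it says nothing in the route's scaling `β'_K → ∞`, proves no crux, rung or summit statement, and the Yang–Mills
mass gap is NOT proved.
-/

set_option autoImplicit false

noncomputable section

namespace Summit.QuantumFields.YangMills.Theorems.ColdStartUniversality

open MeasureTheory Matrix Complex Finset
open scoped ComplexConjugate BigOperators Matrix
open Literature.MathematicalPhysics.QuantumFieldTheory
open Literature.MathematicalPhysics.QuantumLattice (fundamentalRep fundamentalLatticeRep continuous_fundamentalRep fundamentalRep_apply)
open Summit.Ventures.YMGap.HessianSharp (perturb wilsonRe plaqRe plaqReDeriv plaqHess hessianForm tangentNormSq frobSq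
  hasDerivAt_wilsonRe_perturb hasDerivAt_plaqReDeriv_zero abs_hessianForm_le_four_d)

variable {L : ℕ} [NeZero L]

/-! ## §1. Two algebraic facts -/

/-- `‖Σ_ν a_ν E_ν‖² = Σ_ν a_ν²` for the orthonormal family `noiseDir`. [folklore] -/
theorem hsForm_sum_smul_noiseDir_self {N : ℕ} (a : NoiseIdx N → ℝ) :
    hsForm N (∑ ν, a ν • noiseDir ν) (∑ ν, a ν • noiseDir ν) = ∑ ν, a ν ^ 2 := by
  rw [map_sum (hsForm N), LinearMap.sum_apply]
  refine Finset.sum_congr rfl fun ν _ => ?_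
  rw [map_smul, LinearMap.smul_apply, map_sum, smul_eq_mul]
  simp_rw [map_smul, smul_eq_mul, hsForm_noiseDir, mul_ite, mul_one, mul_zero]
  rw [Finset.sum_ite_eq, if_pos (Finset.mem_univ ν), sq]

/-! ## §2. The second frame derivative along `t ↦ e^(tA) Q` is `β' · hessianForm` -/

section Curve

open scoped Matrix.Norms.Operator

/-- **Second derivative along the exponential curve.**  Let `Q, A` be matrix configurations with `A` skew-Hermitian, `φ` a `C²`
function of the real coordinates with `φ(flat M) = β'·wilsonRe M`, and `S` a linear field with `S z = flat(A · rebuild z)`.  Then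
`D(z ↦ Dφ(z)[S z])(flat Q)[S(flat Q)] = β' · hessianForm Q A` (the curve `c(t) = flat(e^(tA)Q)` has `c' = S∘c`, so the left side is
`(φ∘c)''(0)`, and `(wilsonRe(e^(tA)Q))''(0) = hessianForm Q A` by `hasDerivAt_wilsonRe_perturb`, `hasDerivAt_plaqReDeriv_zero`).
[cite: ShenZhuZhu2022, §4 (4.3)] -/
theorem fderiv_frameDeriv_eq_mul_hessianForm (Q A : (Edge 3 L → Matrix (Fin (fundamentalLatticeRep 2).N) (Fin (fundamentalLatticeRep 2).N) ℂ)) (hA : ∀ e, (A e)ᴴ = -A e) (β' : ℝ)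
    (φ : (Edge 3 L × Fin (fundamentalLatticeRep 2).N × Fin (fundamentalLatticeRep 2).N × Bool → ℝ) → ℝ) (hφ : ContDiff ℝ 2 φ)
    (hφW : ∀ M : (Edge 3 L → Matrix (Fin (fundamentalLatticeRep 2).N) (Fin (fundamentalLatticeRep 2).N) ℂ), φ (fun q : Edge 3 L × Fin (fundamentalLatticeRep 2).N × Fin (fundamentalLatticeRep 2).N × Bool => (fun z : ℂ => if q.2.2.2 then z.im else z.re) (M q.1 q.2.1 q.2.2.1)) = β' * wilsonRe M)
    (S : (Edge 3 L × Fin (fundamentalLatticeRep 2).N × Fin (fundamentalLatticeRep 2).N × Bool → ℝ) →L[ℝ] (Edge 3 L × Fin (fundamentalLatticeRep 2).N × Fin (fundamentalLatticeRep 2).N × Bool → ℝ))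
    (hS : ∀ z : (Edge 3 L × Fin (fundamentalLatticeRep 2).N × Fin (fundamentalLatticeRep 2).N × Bool → ℝ), S z = (fun q : Edge 3 L × Fin (fundamentalLatticeRep 2).N × Fin (fundamentalLatticeRep 2).N × Bool => (fun z : ℂ => if q.2.2.2 then z.im else z.re) ((fun (e : Edge 3 L) => A e * (fun (ee : Edge 3 L) => Matrix.of fun (i j : Fin (fundamentalLatticeRep 2).N) => ((z (ee, i, j, false) : ℝ) : ℂ) + ((z (ee, i, j, true) : ℝ) : ℂ) * Complex.I) e) q.1 q.2.1 q.2.2.1))) :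
    fderiv ℝ (fun z => fderiv ℝ φ z (S z)) (fun q : Edge 3 L × Fin (fundamentalLatticeRep 2).N × Fin (fundamentalLatticeRep 2).N × Bool => (fun z : ℂ => if q.2.2.2 then z.im else z.re) (Q q.1 q.2.1 q.2.2.1)) (S (fun q : Edge 3 L × Fin (fundamentalLatticeRep 2).N × Fin (fundamentalLatticeRep 2).N × Bool => (fun z : ℂ => if q.2.2.2 then z.im else z.re) (Q q.1 q.2.1 q.2.2.1))) = β' * hessianForm Q A := by
  classical
  set reb : (Edge 3 L × Fin (fundamentalLatticeRep 2).N × Fin (fundamentalLatticeRep 2).N × Bool → ℝ) → (Edge 3 L → Matrix (Fin (fundamentalLatticeRep 2).N) (Fin (fundamentalLatticeRep 2).N) ℂ) := fun z => (fun (ee : Edge 3 L) => Matrix.of fun (i j : Fin (fundamentalLatticeRep 2).N) => ((z (ee, i, j, false) : ℝ) : ℂ) + ((z (ee, i, j, true) : ℝ) : ℂ) * Complex.I) with hreb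
  set flat : (Edge 3 L → Matrix (Fin (fundamentalLatticeRep 2).N) (Fin (fundamentalLatticeRep 2).N) ℂ) → (Edge 3 L × Fin (fundamentalLatticeRep 2).N × Fin (fundamentalLatticeRep 2).N × Bool → ℝ) := fun M => (fun q : Edge 3 L × Fin (fundamentalLatticeRep 2).N × Fin (fundamentalLatticeRep 2).N × Bool => (fun z : ℂ => if q.2.2.2 then z.im else z.re) (M q.1 q.2.1 q.2.2.1)) with hflat
  have r_flat : ∀ M : (Edge 3 L → Matrix (Fin (fundamentalLatticeRep 2).N) (Fin (fundamentalLatticeRep 2).N) ℂ), reb (flat M) = M := fun M => rebuild_flat_of M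
  have hS' : ∀ z : (Edge 3 L × Fin (fundamentalLatticeRep 2).N × Fin (fundamentalLatticeRep 2).N × Bool → ℝ), S z = flat (fun e => A e * reb z e) := fun z => hS z
  have hφW' : ∀ M : (Edge 3 L → Matrix (Fin (fundamentalLatticeRep 2).N) (Fin (fundamentalLatticeRep 2).N) ℂ), φ (flat M) = β' * wilsonRe M := fun M => hφW M
  -- `flat` as a continuous linear map
  have fl_add : ∀ M M' : (Edge 3 L → Matrix (Fin (fundamentalLatticeRep 2).N) (Fin (fundamentalLatticeRep 2).N) ℂ), flat (M + M') = flat M + flat M' := by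
    intro M M'; funext q; obtain ⟨e, i, j, b⟩ := q
    cases b
    · show ((M + M') e i j).re = (M e i j).re + (M' e i j).re
      rfl
    · show ((M + M') e i j).im = (M e i j).im + (M' e i j).im
      rfl
  have fl_smul : ∀ (a : ℝ) (M : (Edge 3 L → Matrix (Fin (fundamentalLatticeRep 2).N) (Fin (fundamentalLatticeRep 2).N) ℂ)), flat (a • M) = a • flat M := by
    intro a M; funext q; obtain ⟨e, i, j, b⟩ := q
    cases b
    · show (a • M e i j).re = a * (M e i j).re
      rw [Complex.smul_re, smul_eq_mul]
    · show (a • M e i j).im = a * (M e i j).im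
      rw [Complex.smul_im, smul_eq_mul]
  let Fl : (Edge 3 L → Matrix (Fin (fundamentalLatticeRep 2).N) (Fin (fundamentalLatticeRep 2).N) ℂ) →ₗ[ℝ] (Edge 3 L × Fin (fundamentalLatticeRep 2).N × Fin (fundamentalLatticeRep 2).N × Bool → ℝ) := { toFun := flat, map_add' := fl_add, map_smul' := fl_smul }
  let Fc : (Edge 3 L → Matrix (Fin (fundamentalLatticeRep 2).N) (Fin (fundamentalLatticeRep 2).N) ℂ) →L[ℝ] (Edge 3 L × Fin (fundamentalLatticeRep 2).N × Fin (fundamentalLatticeRep 2).N × Bool → ℝ) := LinearMap.toContinuousLinearMap Fl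
  have hFc : ∀ M, Fc M = flat M := fun M => rfl
  -- the curve `t ↦ e^(tA) Q` and its derivative
  set cM : ℝ → (Edge 3 L → Matrix (Fin (fundamentalLatticeRep 2).N) (Fin (fundamentalLatticeRep 2).N) ℂ) := fun t => perturb Q A t with hcM
  have hcM_d : ∀ t, HasDerivAt cM (fun e => A e * NormedSpace.exp (t • A e) * Q e) t := by
    intro t
    refine hasDerivAt_pi.2 fun e => ?_
    exact (hasDerivAt_exp_smul_const' (𝕂 := ℝ) (A e) t).mul_const (Q e)
  have hdir : ∀ t, Fc (fun e => A e * NormedSpace.exp (t • A e) * Q e) = S (flat (cM t)) := by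
    intro t
    rw [hFc, hS']
    have hin : (fun e => A e * NormedSpace.exp (t • A e) * Q e) = fun e => A e * reb (flat (cM t)) e :=
      funext fun e => by rw [r_flat, Matrix.mul_assoc]; rfl
    exact congrArg flat hin
  have hcd : ∀ t, HasDerivAt (fun t => flat (cM t)) (S (flat (cM t))) t := fun t =>
    (Fc.hasFDerivAt.comp_hasDerivAt t (hcM_d t)).congr_deriv (hdir t)
  have hc0 : flat (cM 0) = flat Q := by
    have h0 : cM 0 = Q := funext fun e => by
      simp only [hcM, perturb, zero_smul, NormedSpace.exp_zero, Matrix.one_mul]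
    rw [h0]
  -- first derivative of `φ ∘ c`: `Dφ(c)[S c] = β' Σ_p plaqReDeriv`
  set G : (Edge 3 L × Fin (fundamentalLatticeRep 2).N × Fin (fundamentalLatticeRep 2).N × Bool → ℝ) → ℝ := fun z => fderiv ℝ φ z (S z) with hG
  have hG1 : ContDiff ℝ 1 G := contDiff_frameDeriv (k := 1) hφ S
  have hφd : Differentiable ℝ φ := hφ.differentiable (by norm_num)
  have hGd : Differentiable ℝ G := hG1.differentiable (by norm_num)
  have hd1 : ∀ t, HasDerivAt (fun t => φ (flat (cM t))) (G (flat (cM t))) t := fun t =>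
    (hφd (flat (cM t))).hasFDerivAt.comp_hasDerivAt t (hcd t)
  have hW1 : ∀ t, HasDerivAt (fun t => φ (flat (cM t)))
      (β' * ∑ p : Plaquette 3 L, plaqReDeriv Q A p.1 p.2.1.1 p.2.1.2 t) t := by
    intro t
    have hfun : (fun t => φ (flat (cM t))) = fun t => β' * wilsonRe (perturb Q A t) := funext fun t => hφW' (cM t)
    rw [hfun]
    exact (hasDerivAt_wilsonRe_perturb Q A hA t).const_mul β'
  have hGW : ∀ t, G (flat (cM t)) = β' * ∑ p : Plaquette 3 L, plaqReDeriv Q A p.1 p.2.1.1 p.2.1.2 t :=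
    fun t => (hd1 t).unique (hW1 t)
  -- second derivative at `t = 0`
  have hd2 := (hGd (flat (cM 0))).hasFDerivAt.comp_hasDerivAt 0 (hcd 0)
  have hW2 : HasDerivAt (fun t => G (flat (cM t))) (β' * hessianForm Q A) 0 := by
    have hfun : (fun t => G (flat (cM t))) = fun t => β' * ∑ p : Plaquette 3 L, plaqReDeriv Q A p.1 p.2.1.1 p.2.1.2 t :=
      funext hGW
    rw [hfun]
    exact (HasDerivAt.fun_sum fun p _ => hasDerivAt_plaqReDeriv_zero Q A p.1 p.2.1.1 p.2.1.2).const_mul β'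
  have hkey := hd2.unique hW2
  rw [hc0] at hkey
  exact hkey

end Curve

/-! ## §3. The Hessian bound `K₀ = 24|β'|` along the noise frame -/

/-- ★★ **Explicit Hessian bound for the plaquette function along the noise frame** (the hypothesis `hHess` of
`integral_generator_sq_ge_of_hessBound` / `wilson_generatorPoincare_of_hessBound` with `K₀ = 24|β'|`, uniformly in `L`):
for every configuration `V` and every functional `Λ`,
`Σ_(n,m) Λ(s_n(y))Λ(s_m(y))·D(z ↦ Dψ̂(z)[s_m z])(y)[s_n y] ≤ 24|β'|·Σ_n Λ(s_n(y))²`, `y = coords V`, `ψ̂ = β'Σ_p Re tr U_p`.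
Proof: the left side is `β'·hessianForm(Q, A)` for `Q_e = V_e`, `A_e = √2 Σ_ν Λ(s_(e,ν)) 𝐩E_ν` (skew-Hermitian), bounded by
`|β'|·4·3·Σ_e‖A_e‖²` (venture `abs_hessianForm_le_four_d`) and `Σ_e‖A_e‖² ≤ 2Σ_nΛ(s_n)²`.
[cite: ShenZhuZhu2022, §4 Lemma 4.1] -/
theorem wilson_hessBound (L : ℕ) [NeZero L] (β' : ℝ) :
    (∀ (V : (GaugeConfig 3 L (Matrix.specialUnitaryGroup (Fin 2) ℂ))) (Λ : (Edge 3 L × Fin (fundamentalLatticeRep 2).N × Fin (fundamentalLatticeRep 2).N × Bool → ℝ) →L[ℝ] ℝ),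
      ∑ n : Edge 3 L × NoiseIdx (fundamentalLatticeRep 2).N, ∑ m : Edge 3 L × NoiseIdx (fundamentalLatticeRep 2).N,
        Λ ((fun q : Edge 3 L × Fin (fundamentalLatticeRep 2).N × Fin (fundamentalLatticeRep 2).N × Bool => if n.1 = q.1 then (fun z : ℂ => if q.2.2.2 then z.im else z.re) (((Real.sqrt 2 : ℂ) • ((fundamentalLatticeRep 2).lieProj (noiseDir n.2) * (fun (ee : Edge 3 L) => Matrix.of fun (i j : Fin (fundamentalLatticeRep 2).N) => (((fun (V : GaugeConfig 3 L (Matrix.specialUnitaryGroup (Fin 2) ℂ)) (q : Edge 3 L × Fin (fundamentalLatticeRep 2).N × Fin (fundamentalLatticeRep 2).N × Bool) => (fun z : ℂ => if q.2.2.2 then z.im else z.re) ((fundamentalRep (Fin 2) (V q.1) : Matrix (Fin 2) (Fin 2) ℂ) q.2.1 q.2.2.1)) V (ee, i, j, false) : ℝ) : ℂ) + (((fun (V : GaugeConfig 3 L (Matrix.specialUnitaryGroup (Fin 2) ℂ)) (q : Edge 3 L × Fin (fundamentalLatticeRep 2).N × Fin (fundamentalLatticeRep 2).N × Bool) => (fun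 z : ℂ => if q.2.2.2 then z.im else z.re) ((fundamentalRep (Fin 2) (V q.1) : Matrix (Fin 2) (Fin 2) ℂ) q.2.1 q.2.2.1)) V (ee, i, j, true) : ℝ) : ℂ) * Complex.I) q.1)) q.2.1 q.2.2.1) else 0)) * Λ ((fun q : Edge 3 L × Fin (fundamentalLatticeRep 2).N × Fin (fundamentalLatticeRep 2).N × Bool => if m.1 = q.1 then (fun z : ℂ => if q.2.2.2 then z.im else z.re) (((Real.sqrt 2 : ℂ) • ((fundamentalLatticeRep 2).lieProj (noiseDir m.2) * (fun (ee : Edge 3 L) => Matrix.of fun (i j : Fin (fundamentalLatticeRep 2).N) => (((fun (V : GaugeConfig 3 L (Matrix.specialUnitaryGroup (Fin 2) ℂ)) (q : Edge 3 L × Fin (fundamentalLatticeRep 2).N × Fin (fundamentalLatticeRep 2).N × Bool) => (fun z : ℂ => if q.2.2.2 then z.im else z.re) ((fundamentalRep (Fin 2) (V q.1) : Matrix (Fin 2) (Fin 2) ℂ) q.2.1 q.2.2.1)) V (ee, i, j, false) : ℝ) : ℂ) + (((fun (V : GaugeConfig 3 L (Matrix.specialUnitaryGroup (Fin 2) ℂ))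 (q : Edge 3 L × Fin (fundamentalLatticeRep 2).N × Fin (fundamentalLatticeRep 2).N × Bool) => (fun z : ℂ => if q.2.2.2 then z.im else z.re) ((fundamentalRep (Fin 2) (V q.1) : Matrix (Fin 2) (Fin 2) ℂ) q.2.1 q.2.2.1)) V (ee, i, j, true) : ℝ) : ℂ) * Complex.I) q.1)) q.2.1 q.2.2.1) else 0)) *
          fderiv ℝ (fun z : (Edge 3 L × Fin (fundamentalLatticeRep 2).N × Fin (fundamentalLatticeRep 2).N × Bool → ℝ) => fderiv ℝ (fun y : (Edge 3 L × Fin (fundamentalLatticeRep 2).N × Fin (fundamentalLatticeRep 2).N × Bool → ℝ) => β' * ∑ p : Plaquette 3 L, (rootedLoop (fun (ee : Edge 3 L) (i j : Fin (fundamentalLatticeRep 2).N) => ((y (ee, i, j, false) : ℝ) : ℂ) + ((y (ee, i, j, true) : ℝ) : ℂ) * Complex.I) (p.1, p.2.1.1) p.2.1.2 false).trace.re) z (fun q : Edge 3 L × Fin (fundamentalLatticeRep 2).N × Fin (fundamentalLatticeRep 2).N × Bool => if m.1 = q.1 then (fun z : ℂ => if q.2.2.2 then z.im else z.re) (((Real.sqrt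 2 : ℂ) • ((fundamentalLatticeRep 2).lieProj (noiseDir m.2) * (fun (ee : Edge 3 L) => Matrix.of fun (i j : Fin (fundamentalLatticeRep 2).N) => ((z (ee, i, j, false) : ℝ) : ℂ) + ((z (ee, i, j, true) : ℝ) : ℂ) * Complex.I) q.1)) q.2.1 q.2.2.1) else 0)) ((fun (V : GaugeConfig 3 L (Matrix.specialUnitaryGroup (Fin 2) ℂ)) (q : Edge 3 L × Fin (fundamentalLatticeRep 2).N × Fin (fundamentalLatticeRep 2).N × Bool) => (fun z : ℂ => if q.2.2.2 then z.im else z.re) ((fundamentalRep (Fin 2) (V q.1) : Matrix (Fin 2) (Fin 2) ℂ) q.2.1 q.2.2.1)) V) (fun q : Edge 3 L × Fin (fundamentalLatticeRep 2).N × Fin (fundamentalLatticeRep 2).N × Bool => if n.1 = q.1 then (fun z : ℂ => if q.2.2.2 then z.im else z.re) (((Real.sqrt 2 : ℂ) • ((fundamentalLatticeRep 2).lieProj (noiseDir n.2) * (fun (ee : Edge 3 L) => Matrix.of fun (i j : Fin (fundamentalLatticeRep 2).N) => (((fun (V : GaugeConfig 3 L (Matrix.specialUnitaryGroup (Fin 2)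 ℂ)) (q : Edge 3 L × Fin (fundamentalLatticeRep 2).N × Fin (fundamentalLatticeRep 2).N × Bool) => (fun z : ℂ => if q.2.2.2 then z.im else z.re) ((fundamentalRep (Fin 2) (V q.1) : Matrix (Fin 2) (Fin 2) ℂ) q.2.1 q.2.2.1)) V (ee, i, j, false) : ℝ) : ℂ) + (((fun (V : GaugeConfig 3 L (Matrix.specialUnitaryGroup (Fin 2) ℂ)) (q : Edge 3 L × Fin (fundamentalLatticeRep 2).N × Fin (fundamentalLatticeRep 2).N × Bool) => (fun z : ℂ => if q.2.2.2 then z.im else z.re) ((fundamentalRep (Fin 2) (V q.1) : Matrix (Fin 2) (Fin 2) ℂ) q.2.1 q.2.2.1)) V (ee, i, j, true) : ℝ) : ℂ) * Complex.I) q.1)) q.2.1 q.2.2.1) else 0)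
        ≤ 24 * |β'| * ∑ n : Edge 3 L × NoiseIdx (fundamentalLatticeRep 2).N, (Λ (fun q : Edge 3 L × Fin (fundamentalLatticeRep 2).N × Fin (fundamentalLatticeRep 2).N × Bool => if n.1 = q.1 then (fun z : ℂ => if q.2.2.2 then z.im else z.re) (((Real.sqrt 2 : ℂ) • ((fundamentalLatticeRep 2).lieProj (noiseDir n.2) * (fun (ee : Edge 3 L) => Matrix.of fun (i j : Fin (fundamentalLatticeRep 2).N) => (((fun (V : GaugeConfig 3 L (Matrix.specialUnitaryGroup (Fin 2) ℂ)) (q : Edge 3 L × Fin (fundamentalLatticeRep 2).N × Fin (fundamentalLatticeRep 2).N × Bool) => (fun z : ℂ => if q.2.2.2 then z.im else z.re) ((fundamentalRep (Fin 2) (V q.1) : Matrix (Fin 2) (Fin 2) ℂ) q.2.1 q.2.2.1)) V (ee, i, j, false) : ℝ) : ℂ) + (((fun (V : GaugeConfig 3 L (Matrix.specialUnitaryGroup (Fin 2) ℂ)) (q : Edge 3 L × Fin (fundamentalLatticeRep 2).N × Fin (fundamentalLatticeRep 2).N × Bool) => (fun z : ℂ => if q.2.2.2 then z.im else z.re) ((fundamentalRep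 (Fin 2) (V q.1) : Matrix (Fin 2) (Fin 2) ℂ) q.2.1 q.2.2.1)) V (ee, i, j, true) : ℝ) : ℂ) * Complex.I) q.1)) q.2.1 q.2.2.1) else 0)) ^ 2) := by
  intro V Λ
  classical
  obtain ⟨s, c, hs, -, -, -, -⟩ := exists_noiseFrame L
  -- abbreviations
  set P : NoiseIdx (fundamentalLatticeRep 2).N → Matrix (Fin (fundamentalLatticeRep 2).N) (Fin (fundamentalLatticeRep 2).N) ℂ := fun ν => (fundamentalLatticeRep 2).lieProj (noiseDir ν) with hP
  set reb : (Edge 3 L × Fin (fundamentalLatticeRep 2).N × Fin (fundamentalLatticeRep 2).N × Bool → ℝ) → (Edge 3 L → Matrix (Fin (fundamentalLatticeRep 2).N) (Fin (fundamentalLatticeRep 2).N) ℂ) := fun z => (fun (ee : Edge 3 L) => Matrix.of fun (i j : Fin (fundamentalLatticeRep 2).N) => ((z (ee, i, j, false) : ℝ) : ℂ) + ((z (ee, i, j, true) : ℝ) : ℂ) * Complex.I) with hreb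
  set flat : (Edge 3 L → Matrix (Fin (fundamentalLatticeRep 2).N) (Fin (fundamentalLatticeRep 2).N) ℂ) → (Edge 3 L × Fin (fundamentalLatticeRep 2).N × Fin (fundamentalLatticeRep 2).N × Bool → ℝ) := fun M => (fun q : Edge 3 L × Fin (fundamentalLatticeRep 2).N × Fin (fundamentalLatticeRep 2).N × Bool => (fun z : ℂ => if q.2.2.2 then z.im else z.re) (M q.1 q.2.1 q.2.2.1)) with hflat
  set σ : (Edge 3 L × NoiseIdx (fundamentalLatticeRep 2).N) → (Edge 3 L × Fin (fundamentalLatticeRep 2).N × Fin (fundamentalLatticeRep 2).N × Bool → ℝ) → (Edge 3 L × Fin (fundamentalLatticeRep 2).N × Fin (fundamentalLatticeRep 2).N × Bool → ℝ) := fun n z => (fun q : Edge 3 L × Fin (fundamentalLatticeRep 2).N × Fin (fundamentalLatticeRep 2).N × Bool => if n.1 = q.1 then (fun z : ℂ => if q.2.2.2 then z.im else z.re) (((Real.sqrt 2 : ℂ) • ((fundamentalLatticeRep 2).lieProj (noiseDir n.2) * (fun (ee : Edge 3 L) => Matrix.of fun (i j : Fin (fundamentalLatticeRep 2).N) => ((z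 (ee, i, j, false) : ℝ) : ℂ) + ((z (ee, i, j, true) : ℝ) : ℂ) * Complex.I) q.1)) q.2.1 q.2.2.1) else 0) with hσ
  set ψ : (Edge 3 L × Fin (fundamentalLatticeRep 2).N × Fin (fundamentalLatticeRep 2).N × Bool → ℝ) → ℝ := (fun y : (Edge 3 L × Fin (fundamentalLatticeRep 2).N × Fin (fundamentalLatticeRep 2).N × Bool → ℝ) => β' * ∑ p : Plaquette 3 L, (rootedLoop (fun (ee : Edge 3 L) (i j : Fin (fundamentalLatticeRep 2).N) => ((y (ee, i, j, false) : ℝ) : ℂ) + ((y (ee, i, j, true) : ℝ) : ℂ) * Complex.I) (p.1, p.2.1.1) p.2.1.2 false).trace.re) with hψ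
  set y : (Edge 3 L × Fin (fundamentalLatticeRep 2).N × Fin (fundamentalLatticeRep 2).N × Bool → ℝ) := (fun (V : GaugeConfig 3 L (Matrix.specialUnitaryGroup (Fin 2) ℂ)) (q : Edge 3 L × Fin (fundamentalLatticeRep 2).N × Fin (fundamentalLatticeRep 2).N × Bool) => (fun z : ℂ => if q.2.2.2 then z.im else z.re) ((fundamentalRep (Fin 2) (V q.1) : Matrix (Fin 2) (Fin 2) ℂ) q.2.1 q.2.2.1)) V with hy
  have hsσ : ∀ n z, s n z = σ n z := fun n z => hs n z
  -- §1 facts of `…NoiseFrame` in the abbreviations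
  have r_smul : ∀ (a : ℝ) (v : (Edge 3 L × Fin (fundamentalLatticeRep 2).N × Fin (fundamentalLatticeRep 2).N × Bool → ℝ)), reb (a • v) = (a : ℂ) • reb v := fun a v => rebuild_smul a v
  have r_sum : ∀ f : (Edge 3 L × NoiseIdx (fundamentalLatticeRep 2).N) → (Edge 3 L × Fin (fundamentalLatticeRep 2).N × Fin (fundamentalLatticeRep 2).N × Bool → ℝ), reb (∑ k, f k) = ∑ k, reb (f k) :=
    fun f => rebuild_sum Finset.univ f
  have r_inj : ∀ v w : (Edge 3 L × Fin (fundamentalLatticeRep 2).N × Fin (fundamentalLatticeRep 2).N × Bool → ℝ), reb v = reb w → v = w := fun v w h => eq_of_rebuild_eq h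
  have r_flat : ∀ M : (Edge 3 L → Matrix (Fin (fundamentalLatticeRep 2).N) (Fin (fundamentalLatticeRep 2).N) ℂ), reb (flat M) = M := fun M => rebuild_flat_of M
  have r_σ : ∀ n z, reb (σ n z) = fun e => if n.1 = e then (Real.sqrt 2 : ℂ) • (P n.2 * reb z e) else 0 :=
    fun n z => rebuild_noise n z
  have flat_reb : ∀ v : (Edge 3 L × Fin (fundamentalLatticeRep 2).N × Fin (fundamentalLatticeRep 2).N × Bool → ℝ), flat (reb v) = v := fun v => r_inj _ _ (r_flat _)
  -- the coefficients `x_n = Λ(s_n y)` and the combined field `S = Σ_n x_n s_n`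
  set x : Edge 3 L × NoiseIdx (fundamentalLatticeRep 2).N → ℝ := fun n => Λ (s n y) with hx
  set S : (Edge 3 L × Fin (fundamentalLatticeRep 2).N × Fin (fundamentalLatticeRep 2).N × Bool → ℝ) →L[ℝ] (Edge 3 L × Fin (fundamentalLatticeRep 2).N × Fin (fundamentalLatticeRep 2).N × Bool → ℝ) := ∑ n, x n • s n with hSdef
  have hS_apply : ∀ z, S z = ∑ n, x n • s n z := fun z => by
    rw [hSdef, _root_.sum_apply]
    simp only [FunLike.coe_smul, Pi.smul_apply]
  -- the matrices `Z_e = Σ_ν x_(e,ν) 𝐩E_ν ∈ 𝔤`, `A_e = √2 Z_e`, `Q_e = V_e`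
  set Z : Edge 3 L → Matrix (Fin (fundamentalLatticeRep 2).N) (Fin (fundamentalLatticeRep 2).N) ℂ := fun e => ∑ ν, x (e, ν) • P ν with hZ
  set A : Edge 3 L → Matrix (Fin (fundamentalLatticeRep 2).N) (Fin (fundamentalLatticeRep 2).N) ℂ := fun e => (Real.sqrt 2 : ℂ) • Z e with hA
  set Q : Edge 3 L → Matrix (Fin (fundamentalLatticeRep 2).N) (Fin (fundamentalLatticeRep 2).N) ℂ := fun e => Matrix.of fun i j : Fin (fundamentalLatticeRep 2).N =>
    (fundamentalRep (Fin 2) (V e) : Matrix (Fin 2) (Fin 2) ℂ) i j with hQ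
  have hrebY : reb y = Q := rebuild_coords_of V
  have hyQ : flat Q = y := by rw [← hrebY, flat_reb]
  have hZmem : ∀ e, Z e ∈ (fundamentalLatticeRep 2).lieAlg := fun e =>
    Submodule.sum_mem _ fun ν _ => Submodule.smul_mem _ _ ((fundamentalLatticeRep 2).lieProj_mem _)
  have hZskew : ∀ e, (Z e)ᴴ = -Z e := fun e => by
    rw [← Matrix.star_eq_conjTranspose]
    exact (fundamentalLatticeRep 2).star_eq_neg_of_mem_lieAlg (hZmem e)
  have hAskew : ∀ e, (A e)ᴴ = -A e := fun e => by
    simp only [hA, Matrix.conjTranspose_smul, RCLike.star_def, Complex.conj_ofReal, hZskew, smul_neg]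
  have hQU : ∀ e, Q e ∈ Matrix.unitaryGroup (Fin (fundamentalLatticeRep 2).N) ℂ := fun e =>
    Matrix.specialUnitaryGroup_le_unitaryGroup (V e).2
  -- real vs complex scalars on matrices
  have cx : ∀ (a : ℝ) (W : Matrix (Fin (fundamentalLatticeRep 2).N) (Fin (fundamentalLatticeRep 2).N) ℂ), a • W = (a : ℂ) • W := fun a W => by
    ext i j
    simp only [Matrix.smul_apply, Complex.real_smul, smul_eq_mul]
  -- (F1) `rebuild (S z) = (A_e · rebuild(z)_e)_e`, i.e. `S z = flat(A · rebuild z)`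
  have hrebS : ∀ z, reb (S z) = fun e => A e * reb z e := by
    intro z
    rw [hS_apply, r_sum]
    simp_rw [r_smul, hsσ, r_σ]
    funext e
    rw [Finset.sum_apply]
    have hsplit : ∑ n : Edge 3 L × NoiseIdx (fundamentalLatticeRep 2).N,
        ((x n : ℂ) • (fun e' : Edge 3 L => if n.1 = e' then (Real.sqrt 2 : ℂ) • (P n.2 * reb z e') else (0 : Matrix (Fin (fundamentalLatticeRep 2).N) (Fin (fundamentalLatticeRep 2).N) ℂ))) e
        = ∑ e' : Edge 3 L, ∑ ν : NoiseIdx (fundamentalLatticeRep 2).N,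
          ((x (e', ν) : ℂ) • (fun e'' : Edge 3 L => if (e', ν).1 = e'' then (Real.sqrt 2 : ℂ) • (P (e', ν).2 * reb z e'') else (0 : Matrix (Fin (fundamentalLatticeRep 2).N) (Fin (fundamentalLatticeRep 2).N) ℂ))) e :=
      Fintype.sum_prod_type _
    rw [hsplit, Finset.sum_eq_single e (fun e' _ hne => Finset.sum_eq_zero fun ν _ => by
      simp only [Pi.smul_apply, if_neg hne, smul_zero]) (fun h => absurd (Finset.mem_univ e) h)]
    simp only [Pi.smul_apply, if_true, hA, hZ, Finset.smul_sum, Finset.sum_mul, Matrix.smul_mul]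
    refine Finset.sum_congr rfl fun ν _ => ?_
    rw [cx, smul_comm]
  have hSflat : ∀ z, S z = flat (fun e => A e * reb z e) := fun z =>
    r_inj _ _ ((hrebS z).trans (r_flat _).symm)
  -- `ψ̂(flat M) = β' · wilsonRe M`
  have hψW : ∀ M : (Edge 3 L → Matrix (Fin (fundamentalLatticeRep 2).N) (Fin (fundamentalLatticeRep 2).N) ℂ), ψ (flat M) = β' * wilsonRe M := by
    intro M
    have h1 : ψ (flat M) = β' * ∑ p : Plaquette 3 L, (rootedLoop (reb (flat M)) (p.1, p.2.1.1) p.2.1.2 false).trace.re := rfl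
    rw [h1, r_flat]
    simp only [wilsonRe, plaqRe, rootedLoop]
  have hψC : ContDiff ℝ 2 ψ := contDiff_psiHat (d := 3) (L := L) (N := (fundamentalLatticeRep 2).N) (n := 2) β'
  -- (F2) the second frame derivative is `β' · hessianForm Q A`
  have hkey : fderiv ℝ (fun z => fderiv ℝ ψ z (S z)) y (S y) = β' * hessianForm Q A := by
    have h : fderiv ℝ (fun z => fderiv ℝ ψ z (S z)) (flat Q) (S (flat Q)) = β' * hessianForm Q A :=
      fderiv_frameDeriv_eq_mul_hessianForm Q A hAskew β' ψ hψC hψW S hSflat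
    rw [hyQ] at h
    exact h
  -- (F3) bilinear expansion of the left side
  have hexp : fderiv ℝ (fun z => fderiv ℝ ψ z (S z)) y (S y)
      = ∑ n, ∑ m, x n * x m * fderiv ℝ (fun z => fderiv ℝ ψ z (s m z)) y (s n y) := by
    have hGsum : (fun z => fderiv ℝ ψ z (S z)) = fun z => ∑ m, x m * fderiv ℝ ψ z (s m z) := by
      funext z
      rw [hS_apply, map_sum]
      exact Finset.sum_congr rfl fun m _ => by rw [map_smul, smul_eq_mul]
    rw [hGsum, fderiv_sum_mul_apply Finset.univ x (fun m _ => differentiableAt_frameDeriv hψC (s m) y) (S y)]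
    simp_rw [hS_apply, map_sum, map_smul, smul_eq_mul, Finset.mul_sum]
    rw [Finset.sum_comm]
    refine Finset.sum_congr rfl fun n _ => Finset.sum_congr rfl fun m _ => ?_
    ring
  have hE : ∑ n, ∑ m, x n * x m * fderiv ℝ (fun z => fderiv ℝ ψ z (s m z)) y (s n y) = β' * hessianForm Q A := by
    rw [← hexp]; exact hkey
  -- (F4) the venture's sharp Hessian bound, `d = 3`
  have hH : |hessianForm Q A| ≤ 12 * tangentNormSq A := by
    have h := abs_hessianForm_le_four_d Q A hQU
    push_cast at h
    linarith
  -- (F5) `Σ_e ‖A_e‖² ≤ 2 Σ_n x_n²`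
  have hT : tangentNormSq A ≤ 2 * ∑ n, x n ^ 2 := by
    have hTe : tangentNormSq A = ∑ e, hsForm (fundamentalLatticeRep 2).N (A e) (A e) := rfl
    have hAe : ∀ e, hsForm (fundamentalLatticeRep 2).N (A e) (A e) = 2 * hsForm (fundamentalLatticeRep 2).N (Z e) (Z e) := fun e => by
      show hsForm (fundamentalLatticeRep 2).N ((Real.sqrt 2 : ℂ) • Z e) ((Real.sqrt 2 : ℂ) • Z e) = _
      rw [hsForm_coe_smul_left, hsForm_coe_smul_right, ← mul_assoc, Real.mul_self_sqrt zero_le_two]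
    have hZe : ∀ e, hsForm (fundamentalLatticeRep 2).N (Z e) (Z e) ≤ ∑ ν, x (e, ν) ^ 2 := fun e => by
      have hZp : Z e = (fundamentalLatticeRep 2).lieProj (∑ ν, x (e, ν) • noiseDir ν) := by
        show ∑ ν, x (e, ν) • P ν = _
        rw [map_sum]
        simp only [map_smul, hP]
      rw [hZp, ← hsForm_sum_smul_noiseDir_self]
      exact hsForm_lieProj_self_le (fundamentalLatticeRep 2) _
    have hsum : ∑ e, hsForm (fundamentalLatticeRep 2).N (Z e) (Z e) ≤ ∑ e : Edge 3 L, ∑ ν : NoiseIdx (fundamentalLatticeRep 2).N, x (e, ν) ^ 2 :=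
      Finset.sum_le_sum fun e _ => hZe e
    have hprod : ∑ n, x n ^ 2 = ∑ e : Edge 3 L, ∑ ν : NoiseIdx (fundamentalLatticeRep 2).N, x (e, ν) ^ 2 :=
      Fintype.sum_prod_type (fun n : Edge 3 L × NoiseIdx (fundamentalLatticeRep 2).N => x n ^ 2)
    rw [hTe, hprod, Finset.sum_congr rfl fun e _ => hAe e, ← Finset.mul_sum]
    linarith
  -- assembly
  have hxn : 0 ≤ ∑ n, x n ^ 2 := Finset.sum_nonneg fun n _ => sq_nonneg _
  have main : ∑ n, ∑ m, x n * x m * fderiv ℝ (fun z => fderiv ℝ ψ z (s m z)) y (s n y) ≤ 24 * |β'| * ∑ n, x n ^ 2 := by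
    rw [hE]
    calc β' * hessianForm Q A ≤ |β' * hessianForm Q A| := le_abs_self _
      _ = |β'| * |hessianForm Q A| := abs_mul _ _
      _ ≤ |β'| * (12 * tangentNormSq A) := mul_le_mul_of_nonneg_left hH (abs_nonneg _)
      _ ≤ |β'| * (12 * (2 * ∑ n, x n ^ 2)) :=
          mul_le_mul_of_nonneg_left (mul_le_mul_of_nonneg_left hT (by norm_num)) (abs_nonneg _)
      _ = 24 * |β'| * ∑ n, x n ^ 2 := by ring
  -- back to the statement's vocabulary
  have hsz : ∀ k : Edge 3 L × NoiseIdx (fundamentalLatticeRep 2).N, (fun z : (Edge 3 L × Fin (fundamentalLatticeRep 2).N × Fin (fundamentalLatticeRep 2).N × Bool → ℝ) => fderiv ℝ ψ z (s k z)) = fun z => fderiv ℝ ψ z (σ k z) :=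
    fun k => funext fun z => congrArg (fderiv ℝ ψ z) (hs k z)
  have hsV : ∀ k : Edge 3 L × NoiseIdx (fundamentalLatticeRep 2).N, s k y = σ k y := fun k => hs k y
  simp only [hx, hsz, hsV] at main
  exact main

/-! ## §4. The unconditional volume-uniform Poincaré inequality -/

/-- ★★★ **Volume-uniform Poincaré inequality for the `SU(2)` Wilson measure at small `|β'|`, generator form.**
For every torus size `L`, every `β'` with `|β'| < 1/12`, and every `C³` function `f` of the real link coordinates, with
`F = f∘coords`, `m = ∫ F dμ_(β')` and `𝓛_(β')` the coordinate generator of the SZZ Langevin dynamics: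
`(1 − 12|β'|) · ∫ (F − m)² dμ_(β') ≤ −∫ (F − m) · 𝓛_(β') f dμ_(β')` — spectral gap `≥ 1 − 12|β'|`, independent of `L`
(Bakry–Émery: `Ric = 1`, `|Hess ψ̂| ≤ 24|β'|·Γ` along the frame, `ρ = 1 − K₀/2`).  Fixed cut-off only.
[cite: ShenZhuZhu2022, §4 Theorem 4.2, Corollary 4.4 (4.11)] -/
theorem wilson_generatorPoincare_uniform (L : ℕ) [NeZero L] (β' : ℝ) (hβ : |β'| < 1 / 12)
    (f : (Edge 3 L × Fin 2 × Fin 2 × Bool → ℝ) → ℝ) (hf : ContDiff ℝ 3 f) :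
    let coords : GaugeConfig 3 L (Matrix.specialUnitaryGroup (Fin 2) ℂ) → (Edge 3 L × Fin 2 × Fin 2 × Bool → ℝ) :=
      fun V q => (fun z : ℂ => if q.2.2.2 then z.im else z.re)
        ((fundamentalRep (Fin 2) (V q.1) : Matrix (Fin 2) (Fin 2) ℂ) q.2.1 q.2.2.1)
    let gen : ((Edge 3 L × Fin 2 × Fin 2 × Bool → ℝ) → ℝ) → GaugeConfig 3 L (Matrix.specialUnitaryGroup (Fin 2) ℂ) → ℝ :=
      fun h V =>
      (∑ i : Edge 3 L × Fin 2 × Fin 2 × Bool, fderiv ℝ h (coords V) (Pi.single i 1) *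
          (fun z : ℂ => if i.2.2.2 then z.im else z.re)
            ((latticeLangevinDynamics (fundamentalLatticeRep 2) β').drift
              (matrixConfig (fundamentalRep (Fin 2)) V) i.1 i.2.1 i.2.2.1) +
      1 / 2 * ∑ i : Edge 3 L × Fin 2 × Fin 2 × Bool, ∑ j : Edge 3 L × Fin 2 × Fin 2 × Bool,
        fderiv ℝ (fun z => fderiv ℝ h z (Pi.single i 1)) (coords V) (Pi.single j 1) *
          ∑ n : Edge 3 L × NoiseIdx 2,
            (if n.1 = i.1 then (fun z : ℂ => if i.2.2.2 then z.im else z.re)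
              ((latticeLangevinDynamics (fundamentalLatticeRep 2) β').noise
                (matrixConfig (fundamentalRep (Fin 2)) V) i.1 n.2 i.2.1 i.2.2.1) else 0) *
            (if n.1 = j.1 then (fun z : ℂ => if j.2.2.2 then z.im else z.re)
              ((latticeLangevinDynamics (fundamentalLatticeRep 2) β').noise
                (matrixConfig (fundamentalRep (Fin 2)) V) j.1 n.2 j.2.1 j.2.2.1) else 0))
    (1 - 12 * |β'|) * ∫ V, (f (coords V) - ∫ V', f (coords V') ∂(wilsonMeasure (d := 3) (L := L) (fundamentalRep (Fin 2)) β')) ^ 2 ∂(wilsonMeasure (d := 3) (L := L) (fundamentalRep (Fin 2)) β') ≤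
      -∫ V, (f (coords V) - ∫ V', f (coords V') ∂(wilsonMeasure (d := 3) (L := L) (fundamentalRep (Fin 2)) β')) * gen f V ∂(wilsonMeasure (d := 3) (L := L) (fundamentalRep (Fin 2)) β') := by
  intro coords gen
  have h := wilson_generatorPoincare_of_hessBound L β' (24 * |β'|) (by linarith) (wilson_hessBound L β') f hf
  have e : (1 - 24 * |β'| / 2 : ℝ) = 1 - 12 * |β'| := by ring
  rw [e] at h
  exact h

end Summit.QuantumFields.YangMills.Theorems.ColdStartUniversality
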